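import Summits.SmoothPoincare4.SmoothPoincare4.Theorems.DottedCircleRasmussenDcrGapHelperFriendsCarrierVkPartAPartICollarIn
import Summits.SmoothPoincare4.SmoothPoincare4.Theorems.DottedCircleRasmussenDcrGapHelperFriendsCarrierVkPartAPartICollarOut
import Summits.SmoothPoincare4.SmoothPoincare4.Theorems.DottedCircleRasmussenDcrGapHelperFriendsCarrierVkPartAPartIFunctionals
import Summits.SmoothPoincare4.SmoothPoincare4.Theorems.DottedCircleRasmussenDcrGapHelperFriendsCarrierVkPartAPartIGeoValues

/-!
# Helper `helper_friendsCarrier_Vk_partA_partI` (V_k part A, part I: the tube framing is the Seifert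
framing), piece 8: the Mayer–Vietoris bookkeeping in the picture
(line `mk_friends`, crux `DcrGap`; item stmt-SmoothPoincare4-16128, route route-SmoothPoincare4-DottedCircleRasmussen)

**A class of the collar `W = P(M_k ∩ {0 < |w|² < ε})` which dies in `O = 𝕊³ ∖ P(M_k ∩ {|w|² ≥ ε})` and has zero
planar windings about all the holes is a multiple of the class of a fibre circle of the OUTER core.**
This is the homological content of Kirby's `M_k = S³_0(k-component unlink)` for part I: by the clopen partition of
`W` (piece 4) and Hatcher's Prop. 2.6 the class is a sum of classes supported in the `k + 1` collars, each of which
is a combination `a_i h(A_i) + b_i h(B_i)` of the core-parallel loop and the fibre circle (pieces 2–3); the axis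
functional (piece 5) kills everything but `a₀ · 2πi`, so `a₀ = 0`; the winding about `c_j` then kills everything
but `a_j · 2πi`, so `a_j = 0`; the revolution functional of the hole `j` kills everything but `−b_j · 2πi`, so
`b_j = 0` (`j` inner); what is left is `b₀ h(B₀)`.  (In `M_k` the fibre circle `B₀` bounds the normal disc of the
outer core circle — used by the final assembly.)

* `helper_friendsCarrier_Vk_partA_partI_geo` — the registered statement.

No definitions, no named facts, no `sorry`.

## References

* R. Kirby, *The Topology of 4-Manifolds*, LNM 1374 (1989), Ch. I §2, Lemma 2.1. [Kirby1989]
* A. Hatcher, *Algebraic Topology*, CUP (2002), Prop. 2.6, §2.2, Thm. 2A.1. [HatcherAT2002]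
-/

set_option linter.dupNamespace false
set_option linter.style.longLine false

noncomputable section

open scoped Manifold ContDiff Topology ComplexConjugate unitInterval
open Function Set Metric TopologicalSpace Literature.Topology.FourManifolds Literature.Topology.FourManifolds.MMSW Literature.AlgebraicTopology.Homotopy.HopfFibration
  Literature.AlgebraicTopology.SingularHomology Literature.AlgebraicTopology.FundamentalGroup.PuncturedPlane

namespace Summit.SmoothPoincare4.SmoothPoincare4.Theorems.DcrGap.MkFriends

open FriendsCarrierVk in
/-- **Piece 8 of part I of V_k part A: the Mayer–Vietoris bookkeeping in the picture.**  For `0 < ε ≤ 1/40`, a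
class of `H₁(W; ℤ)`, `W = P(M_k ∩ {0 < |w|² < ε})`, which vanishes in `O = 𝕊³ ∖ P(M_k ∩ {|w|² ≥ ε})` and is killed
by all the planar windings `z − c_j`, is an integer multiple of the class of a fibre circle
`t ↦ P(z₁, (√ε/2) e^{2πit})` about the outer core circle. [cite: Kirby1989, Ch. I §2, Lemma 2.1] [cite: HatcherAT2002, Prop. 2.6] -/
theorem helper_friendsCarrier_Vk_partA_partI_geo : ∀ (k : ℕ) (ε : ℝ), 0 < ε → ε ≤ 1 / 40 → ∀ (W O : Set (sphere (0 : EuclideanSpace ℝ (Fin 4)) 1)) (hWO : W ⊆ O), W = (fun x : EuclideanSpace ℝ (Fin 4) => stereoNorthInv (draw k x)) '' {x | x ∈ modelBoundary k ∧ wC x ≠ 0 ∧ ‖wC x‖ ^ 2 < ε} → O = ((fun x : EuclideanSpace ℝ (Fin 4) => stereoNorthInv (draw k x)) '' {x | x ∈ modelBoundary k ∧ ε ≤ ‖wC x‖ ^ 2})ᶜ → ∀ d : singularHomology ℤ ℤ ↥W 1, singularHomology.map ℤ ℤ (subsetInclusion hWO) 1 d = 0 → (∀ (j : Fin k) (f :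 C(↥W, CStar)), (∀ y : ↥W, ((f y : CStar) : ℂ) = chartZ k (stereoNorthCoords ((y : sphere (0 : EuclideanSpace ℝ (Fin 4)) 1) : EuclideanSpace ℝ (Fin 4))) - holeCentre k j) → singularHomology.map ℤ ℤ f 1 d = 0) → ∃ (b : ℤ) (z₁ : ℂ) (p : ↥W) (B : Path p p), 20 * ((k : ℝ) + 1) < ‖z₁‖ ∧ coLat k z₁ ≠ 0 ∧ 0 < latS k z₁ ∧ latCoord k z₁ ∈ annulus 0 (latC k - 1 / 50) (latC k + 1 / 50) ∧ planarPot k z₁ = 1 - ε / 4 ∧ (∀ t : unitInterval, ofZW z₁ (((Real.sqrt ε / 2 : ℝ) : ℂ) * Complex.exp ((2 * Real.pi * t : ℝ) * Complex.I)) ∈ modelBoundary k ∧ ((B t : ↥W) : sphere (0 : EuclideanSpace ℝ (Fin 4)) 1) = stereoNorthInv (draw k (ofZW z₁ (((Real.sqrt ε / 2 : ℝ) : ℂ) * Complex.exp ((2 * Real.pi * t : ℝ) * Complex.I))))) ∧ d = b • loopClass ℤ ℤ (1 : ℤ) B := by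
  intro k ε hε hε' W O hWO hW hO d hd hwind
  have hε20 : ε ≤ 1 / 20 := by linarith
  have hk : (0 : ℝ) ≤ k := Nat.cast_nonneg k
  obtain ⟨hsq0, hu1, hut⟩ := geo_half_sqrt hε
  -- the collars and their generators
  set W₀s : Set (sphere (0 : EuclideanSpace ℝ (Fin 4)) 1) := (fun x : EuclideanSpace ℝ (Fin 4) => stereoNorthInv (draw k x)) ''
    {x | x ∈ modelBoundary k ∧ wC x ≠ 0 ∧ ‖wC x‖ ^ 2 < ε ∧ 20 * ((k : ℝ) + 1) < ‖zC x‖} with hW₀s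
  set Wjs : Fin k → Set (sphere (0 : EuclideanSpace ℝ (Fin 4)) 1) := fun j => (fun x : EuclideanSpace ℝ (Fin 4) => stereoNorthInv (draw k x)) ''
    {x | x ∈ modelBoundary k ∧ wC x ≠ 0 ∧ ‖wC x‖ ^ 2 < ε ∧ ‖zC x - holeCentre k j‖ < 27 / 20} with hWjs
  have hW₀W : W₀s ⊆ W := by rw [hW]; exact image_mono fun _ h => ⟨h.1, h.2.1, h.2.2.1⟩
  have hWjW : ∀ j, Wjs j ⊆ W := fun j => by rw [hW]; exact image_mono fun _ h => ⟨h.1, h.2.1, h.2.2.1⟩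
  obtain ⟨p₀, A₀, B₀, hA₀, ⟨z₁, hz₁, hz₁co, hz₁lat, hz₁ann, hz₁pot, hB₀⟩, hgen₀⟩ :=
    helper_friendsCarrier_Vk_partA_partI_collarOut k ε hε hε' W₀s rfl
  have hgenj := fun j => helper_friendsCarrier_Vk_partA_partI_collarIn k ε j hε hε' (Wjs j) rfl
  choose pj Aj Bj hAj hBj hgenj using hgenj
  choose zj hzj1 hzj27 hBj using hBj
  set ι₀ : C(↥W₀s, ↥W) := subsetInclusion hW₀W with hι₀
  set ιj : ∀ j, C(↥(Wjs j), ↥W) := fun j => subsetInclusion (hWjW j) with hιj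
  set cA : Fin (k + 1) → singularHomology ℤ ℤ ↥W 1 := fun i => Fin.cases (loopClass ℤ ℤ (1 : ℤ) (A₀.map ι₀.continuous))
    (fun j => loopClass ℤ ℤ (1 : ℤ) ((Aj j).map (ιj j).continuous)) i with hcA
  set cB : Fin (k + 1) → singularHomology ℤ ℤ ↥W 1 := fun i => Fin.cases (loopClass ℤ ℤ (1 : ℤ) (B₀.map ι₀.continuous))
    (fun j => loopClass ℤ ℤ (1 : ℤ) ((Bj j).map (ιj j).continuous)) i with hcB
  -- the clopen partition of `W` and the decomposition of `d`
  set Ap : Fin (k + 1) → Set ↥W := fun i => Fin.cases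
    {y : ↥W | 20 * ((k : ℝ) + 1) < ‖chartZ k (stereoNorthCoords ((y : sphere (0 : EuclideanSpace ℝ (Fin 4)) 1) : EuclideanSpace ℝ (Fin 4)))‖}
    (fun j => {y : ↥W | ‖chartZ k (stereoNorthCoords ((y : sphere (0 : EuclideanSpace ℝ (Fin 4)) 1) : EuclideanSpace ℝ (Fin 4))) - holeCentre k j‖ < 27 / 20}) i with hAp
  have hpart : IsClopenPartition Ap := partW_isClopenPartition hε hε20 hW
  obtain ⟨S, x, hdx⟩ := singularHomology.exists_eq_sum_map_subsetIncl (R := ℤ) (M := ℤ) hpart 1 d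
  have hpiece : ∀ i, ∃ a b : ℤ, singularHomology.map ℤ ℤ (subsetIncl (Ap i)) 1 (x i) = a • cA i + b • cB i := by
    refine Fin.cases ?_ (fun j => ?_)
    · have hmem : ∀ y : ↥(Ap 0), ((y : ↥W) : sphere (0 : EuclideanSpace ℝ (Fin 4)) 1) ∈ W₀s := fun y => by
        have hy : (y : ↥W) ∈ Ap 0 := y.2
        simp only [hAp, Fin.cases_zero] at hy
        rw [partW_far_eq hε hW] at hy
        exact hy
      let e₀ : C(↥(Ap 0), ↥W₀s) := ⟨fun y => ⟨((y : ↥W) : sphere (0 : EuclideanSpace ℝ (Fin 4)) 1), hmem y⟩,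
        (continuous_subtype_val.comp continuous_subtype_val).subtype_mk hmem⟩
      have hfac : subsetIncl (Ap 0) = ι₀.comp e₀ := by ext y; rfl
      obtain ⟨a, b, h⟩ := hgen₀ (singularHomology.map ℤ ℤ e₀ 1 (x 0))
      refine ⟨a, b, ?_⟩
      rw [hfac, singularHomology.map_comp, ModuleCat.comp_apply, h, map_add, map_zsmul, map_zsmul, map_loopClass, map_loopClass]
      simp only [hcA, hcB, Fin.cases_zero]
    · have hmem : ∀ y : ↥(Ap j.succ), ((y : ↥W) : sphere (0 : EuclideanSpace ℝ (Fin 4)) 1) ∈ Wjs j := fun y => by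
        have hy : (y : ↥W) ∈ Ap j.succ := y.2
        simp only [hAp, Fin.cases_succ] at hy
        rw [partW_near_eq hε hW j] at hy
        exact hy
      let ej : C(↥(Ap j.succ), ↥(Wjs j)) := ⟨fun y => ⟨((y : ↥W) : sphere (0 : EuclideanSpace ℝ (Fin 4)) 1), hmem y⟩,
        (continuous_subtype_val.comp continuous_subtype_val).subtype_mk hmem⟩
      have hfac : subsetIncl (Ap j.succ) = (ιj j).comp ej := by ext y; rfl
      obtain ⟨a, b, h⟩ := hgenj j (singularHomology.map ℤ ℤ ej 1 (x j.succ))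
      refine ⟨a, b, ?_⟩
      rw [hfac, singularHomology.map_comp, ModuleCat.comp_apply, h, map_add, map_zsmul, map_zsmul, map_loopClass, map_loopClass]
      simp only [hcA, hcB, Fin.cases_succ]
  choose a b hab using hpiece
  have hd' : d = ∑ i ∈ S, (a i • cA i + b i • cB i) := by rw [hdx]; exact Finset.sum_congr rfl fun i _ => hab i
  -- evaluation of a functional on the decomposition
  have heval : ∀ Φ : C(↥W, CStar), singularHomology.map ℤ ℤ Φ 1 d =
      ∑ i ∈ S, (a i • singularHomology.map ℤ ℤ Φ 1 (cA i) + b i • singularHomology.map ℤ ℤ Φ 1 (cB i)) := by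
    intro Φ; rw [hd', map_sum]
    exact Finset.sum_congr rfl fun i _ => by rw [map_add, map_zsmul, map_zsmul]
  -- loop shapes, in the forms consumed by the value lemmas
  have hval0 : ∀ t, (((A₀.map ι₀.continuous) t : ↥W) : sphere (0 : EuclideanSpace ℝ (Fin 4)) 1) = A₀ t := fun t => rfl
  have hvalB0 : ∀ t, (((B₀.map ι₀.continuous) t : ↥W) : sphere (0 : EuclideanSpace ℝ (Fin 4)) 1) = B₀ t := fun t => rfl
  have hvalj : ∀ j t, ((((Aj j).map (ιj j).continuous) t : ↥W) : sphere (0 : EuclideanSpace ℝ (Fin 4)) 1) = Aj j t := fun j t => rfl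
  have hvalBj : ∀ j t, ((((Bj j).map (ιj j).continuous) t : ↥W) : sphere (0 : EuclideanSpace ℝ (Fin 4)) 1) = Bj j t := fun j t => rfl
  have shapeA₀ : ∀ t : I, ∃ z : ℂ, 20 * ((k : ℝ) + 1) < ‖z‖ ∧ coLatDir k z = toE2 (Complex.exp ((2 * Real.pi * t : ℝ) * Complex.I)) ∧
      ofZW z ((Real.sqrt ε / 2 : ℝ) : ℂ) ∈ modelBoundary k ∧ (((A₀.map ι₀.continuous) t : ↥W) : sphere (0 : EuclideanSpace ℝ (Fin 4)) 1) =
        stereoNorthInv (draw k (ofZW z ((Real.sqrt ε / 2 : ℝ) : ℂ))) := fun t => by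
    obtain ⟨z, h1, -, -, -, h5, h6, h7⟩ := hA₀ t; exact ⟨z, h1, h5, h6, h7⟩
  have shapeA₀' : ∀ t : I, ∃ z w : ℂ, (∀ J : Fin k, 27 / 20 ≤ ‖z - holeCentre k J‖) ∧ w ≠ 0 ∧ ofZW z w ∈ modelBoundary k ∧
      (((A₀.map ι₀.continuous) t : ↥W) : sphere (0 : EuclideanSpace ℝ (Fin 4)) 1) = stereoNorthInv (draw k (ofZW z w)) := fun t => by
    obtain ⟨z, h1, -, -, -, -, h6, h7⟩ := hA₀ t
    refine ⟨z, _, fun J => ?_, hsq0, h6, h7⟩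
    have := norm_le_norm_sub_add z (holeCentre k J); have := norm_holeCentre_le (r := k) J; linarith
  have hz₁away : ∀ J : Fin k, 27 / 20 ≤ ‖z₁ - holeCentre k J‖ := fun J => by
    have := norm_le_norm_sub_add z₁ (holeCentre k J); have := norm_holeCentre_le (r := k) J; linarith
  have shapeB₀ : ∀ t : I, ∃ w : ℂ, w ≠ 0 ∧ ofZW z₁ w ∈ modelBoundary k ∧
      (((B₀.map ι₀.continuous) t : ↥W) : sphere (0 : EuclideanSpace ℝ (Fin 4)) 1) = stereoNorthInv (draw k (ofZW z₁ w)) := fun t =>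
    ⟨_, (hut _).2, (hB₀ t).1, (hB₀ t).2⟩
  have shapeAj : ∀ (j : Fin k) (t : I), ∃ z : ℂ, ‖z - holeCentre k j‖ < 27 / 20 ∧ unitDir (holeCentre k j) z = Complex.exp ((2 * Real.pi * t : ℝ) * Complex.I) ∧
      ofZW z ((Real.sqrt ε / 2 : ℝ) : ℂ) ∈ modelBoundary k ∧ ((((Aj j).map (ιj j).continuous) t : ↥W) : sphere (0 : EuclideanSpace ℝ (Fin 4)) 1) =
        stereoNorthInv (draw k (ofZW z ((Real.sqrt ε / 2 : ℝ) : ℂ))) := fun j t => by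
    obtain ⟨z, -, h2, h3, h4, h5⟩ := hAj j t; exact ⟨z, h2, h3, h4, h5⟩
  have shapeBj : ∀ (j : Fin k) (t : I), ∃ w : ℂ, w ≠ 0 ∧ ofZW (zj j) w ∈ modelBoundary k ∧
      ((((Bj j).map (ιj j).continuous) t : ↥W) : sphere (0 : EuclideanSpace ℝ (Fin 4)) 1) = stereoNorthInv (draw k (ofZW (zj j) w)) := fun j t =>
    ⟨_, (hut _).2, (hBj j t).1, (hBj j t).2⟩
  have shapeAj' : ∀ (j : Fin k) (t : I), ∃ z w : ℂ, ‖z - holeCentre k j‖ < 27 / 20 ∧ w ≠ 0 ∧ ofZW z w ∈ modelBoundary k ∧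
      ((((Aj j).map (ιj j).continuous) t : ↥W) : sphere (0 : EuclideanSpace ℝ (Fin 4)) 1) = stereoNorthInv (draw k (ofZW z w)) := fun j t => by
    obtain ⟨z, h2, -, h4, h5⟩ := shapeAj j t; exact ⟨z, _, h2, hsq0, h4, h5⟩
  have hzjaway : ∀ J j : Fin k, j ≠ J → 27 / 20 ≤ ‖zj j - holeCentre k J‖ := fun J j hjJ => by
    have := norm_sub_holeCentre_ge_of_near (hzj27 j).le (Ne.symm hjJ); linarith
  -- the functionals
  obtain ⟨f₀, hf₀⟩ := funcO_exists_axis hε hε20 hO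
  have hfj := fun J => funcO_exists_revolution hε hε20 hO J
  choose fJ hfJ using hfj
  have hwindJ : ∀ J : Fin k, ∃ windJ : C(↥W, CStar), ∀ y : ↥W, ((windJ y : CStar) : ℂ) =
      chartZ k (stereoNorthCoords ((y : sphere (0 : EuclideanSpace ℝ (Fin 4)) 1) : EuclideanSpace ℝ (Fin 4))) - holeCentre k J := by
    intro J
    have hne : ∀ y : ↥W, chartZ k (stereoNorthCoords ((y : sphere (0 : EuclideanSpace ℝ (Fin 4)) 1) : EuclideanSpace ℝ (Fin 4))) - holeCentre k J ≠ 0 := by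
      intro y
      obtain ⟨-, -, -, x, hx, -, -, -, hz⟩ := partW_point hε (show ((y : ↥W) : sphere (0 : EuclideanSpace ℝ (Fin 4)) 1) ∈
        (fun x : EuclideanSpace ℝ (Fin 4) => stereoNorthInv (draw k x)) '' {x | x ∈ modelBoundary k ∧ wC x ≠ 0 ∧ ‖wC x‖ ^ 2 < ε} from by
          rw [← hW]; exact y.2)
      rw [hz, sub_ne_zero]; exact zC_ne_holeCentre hx.1 J
    exact ⟨⟨fun y => ⟨_, hne y⟩, ((partW_continuous_chartZ hε hW).sub continuous_const).subtype_mk hne⟩, fun y => rfl⟩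
  choose windJ hwJ using hwindJ
  have hF₀d : singularHomology.map ℤ ℤ (f₀.comp (subsetInclusion hWO)) 1 d = 0 := by
    rw [singularHomology.map_comp, ModuleCat.comp_apply, hd, map_zero]
  have hFJd : ∀ J : Fin k, singularHomology.map ℤ ℤ ((fJ J).comp (subsetInclusion hWO)) 1 d = 0 := fun J => by
    rw [singularHomology.map_comp, ModuleCat.comp_apply, hd, map_zero]
  have hwJd : ∀ J : Fin k, singularHomology.map ℤ ℤ (windJ J) 1 d = 0 := fun J => hwind J (windJ J) (hwJ J)
  -- values of the axis functional
  have vA0 : windH (singularHomology.map ℤ ℤ (f₀.comp (subsetInclusion hWO)) 1 (cA 0)) = 2 * Real.pi * Complex.I := by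
    simp only [hcA, Fin.cases_zero]; exact geo_axis_farPar hε hWO f₀ hf₀ _ shapeA₀
  have vAj : ∀ j : Fin k, singularHomology.map ℤ ℤ (f₀.comp (subsetInclusion hWO)) 1 (cA j.succ) = 0 := fun j => by
    simp only [hcA, Fin.cases_succ]; exact geo_axis_near hWO f₀ hf₀ _ j (shapeAj' j)
  have vB0 : singularHomology.map ℤ ℤ (f₀.comp (subsetInclusion hWO)) 1 (cB 0) = 0 := by
    simp only [hcB, Fin.cases_zero]; exact geo_axis_farFib hWO f₀ hf₀ _ z₁ hz₁ shapeB₀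
  have vBj : ∀ j : Fin k, singularHomology.map ℤ ℤ (f₀.comp (subsetInclusion hWO)) 1 (cB j.succ) = 0 := fun j => by
    simp only [hcB, Fin.cases_succ]
    exact geo_axis_near hWO f₀ hf₀ _ j fun t => by obtain ⟨w, hw0, hM, hval⟩ := shapeBj j t; exact ⟨zj j, w, hzj27 j, hw0, hM, hval⟩
  -- values of the planar windings
  have vwAJ : ∀ J : Fin k, windH (singularHomology.map ℤ ℤ (windJ J) 1 (cA J.succ)) = 2 * Real.pi * Complex.I := fun J => by
    simp only [hcA, Fin.cases_succ]
    exact geo_wind_nearPar_self (windJ J) J (hwJ J) _ fun t => by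
      obtain ⟨z, -, h3, h4, h5⟩ := shapeAj J t; exact ⟨z, _, h3, hsq0, h4, h5⟩
  have vwAother : ∀ J j : Fin k, j ≠ J → singularHomology.map ℤ ℤ (windJ J) 1 (cA j.succ) = 0 := fun J j hjJ => by
    simp only [hcA, Fin.cases_succ]; exact geo_wind_nearPar_other (windJ J) J j hjJ (hwJ J) _ (shapeAj' j)
  have vwB0 : ∀ J : Fin k, singularHomology.map ℤ ℤ (windJ J) 1 (cB 0) = 0 := fun J => by
    simp only [hcB, Fin.cases_zero]; exact geo_wind_fib (windJ J) J (hwJ J) _ z₁ shapeB₀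
  have vwBj : ∀ J j : Fin k, singularHomology.map ℤ ℤ (windJ J) 1 (cB j.succ) = 0 := fun J j => by
    simp only [hcB, Fin.cases_succ]; exact geo_wind_fib (windJ J) J (hwJ J) _ (zj j) (shapeBj j)
  -- values of the revolution functionals
  have vrBJ : ∀ J : Fin k, windH (singularHomology.map ℤ ℤ ((fJ J).comp (subsetInclusion hWO)) 1 (cB J.succ)) = 2 * Real.pi * (-1 : ℤ) * Complex.I := fun J => by
    simp only [hcB, Fin.cases_succ]; exact geo_rev_nearFib_self hε hWO J (fJ J) (hfJ J) _ (zj J) (hzj27 J) (hBj J)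
  have vrAJ : ∀ J : Fin k, singularHomology.map ℤ ℤ ((fJ J).comp (subsetInclusion hWO)) 1 (cA J.succ) = 0 := fun J => by
    simp only [hcA, Fin.cases_succ]
    exact geo_rev_nearPar_self hε hWO J (fJ J) (hfJ J) _ fun t => by obtain ⟨z, h2, -, h4, h5⟩ := shapeAj J t; exact ⟨z, h2, h4, h5⟩
  have vrAother : ∀ J j : Fin k, j ≠ J → singularHomology.map ℤ ℤ ((fJ J).comp (subsetInclusion hWO)) 1 (cA j.succ) = 0 := fun J j hjJ => by
    simp only [hcA, Fin.cases_succ]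
    exact geo_rev_away hWO J (fJ J) (hfJ J) _ fun t => by
      obtain ⟨z, h2, -, h4, h5⟩ := shapeAj j t
      exact ⟨z, _, by have := norm_sub_holeCentre_ge_of_near h2.le (Ne.symm hjJ); linarith, hsq0, h4, h5⟩
  have vrA0 : ∀ J : Fin k, singularHomology.map ℤ ℤ ((fJ J).comp (subsetInclusion hWO)) 1 (cA 0) = 0 := fun J => by
    simp only [hcA, Fin.cases_zero]
    exact geo_rev_away hWO J (fJ J) (hfJ J) _ fun t => by obtain ⟨z, w, ha, hw0, hM, hval⟩ := shapeA₀' t; exact ⟨z, w, ha J, hw0, hM, hval⟩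
  have vrB0 : ∀ J : Fin k, singularHomology.map ℤ ℤ ((fJ J).comp (subsetInclusion hWO)) 1 (cB 0) = 0 := fun J => by
    simp only [hcB, Fin.cases_zero]
    exact geo_rev_away hWO J (fJ J) (hfJ J) _ fun t => by obtain ⟨w, hw0, hM, hval⟩ := shapeB₀ t; exact ⟨z₁, w, hz₁away J, hw0, hM, hval⟩
  have vrBother : ∀ J j : Fin k, j ≠ J → singularHomology.map ℤ ℤ ((fJ J).comp (subsetInclusion hWO)) 1 (cB j.succ) = 0 := fun J j hjJ => by
    simp only [hcB, Fin.cases_succ]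
    exact geo_rev_away hWO J (fJ J) (hfJ J) _ fun t => by obtain ⟨w, hw0, hM, hval⟩ := shapeBj j t; exact ⟨zj j, w, hzjaway J j hjJ, hw0, hM, hval⟩
  -- the coefficients vanish
  have ha0 : (0 : Fin (k + 1)) ∈ S → a 0 = 0 := fun h0 => by
    have hsum := heval (f₀.comp (subsetInclusion hWO))
    rw [hF₀d, Finset.sum_eq_single_of_mem (0 : Fin (k + 1)) h0 fun i _ hi0 => ?_] at hsum
    · rw [vB0, zsmul_zero, add_zero] at hsum
      exact eq_zero_of_zsmul_eq_zero_of_windH (m := 1) one_ne_zero (by rw [vA0]; push_cast; ring) hsum.symm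
    · obtain ⟨j, rfl⟩ := Fin.exists_succ_eq.2 hi0
      rw [vAj, vBj, zsmul_zero, zsmul_zero, add_zero]
  have haJ : ∀ J : Fin k, J.succ ∈ S → a J.succ = 0 := fun J hJ => by
    have hsum := heval (windJ J)
    rw [hwJd, Finset.sum_eq_single_of_mem J.succ hJ fun i hi hiJ => ?_] at hsum
    · rw [vwBj, zsmul_zero, add_zero] at hsum
      exact eq_zero_of_zsmul_eq_zero_of_windH (m := 1) one_ne_zero (by rw [vwAJ]; push_cast; ring) hsum.symm
    · revert hi hiJ
      refine Fin.cases (fun hi _ => ?_) (fun j hi hiJ => ?_) i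
      · rw [ha0 hi, zero_zsmul, zero_add, vwB0, zsmul_zero]
      · have hjJ : j ≠ J := fun h => hiJ (by rw [h])
        rw [vwAother J j hjJ, vwBj, zsmul_zero, zsmul_zero, add_zero]
  have hbJ : ∀ J : Fin k, J.succ ∈ S → b J.succ = 0 := fun J hJ => by
    have hsum := heval ((fJ J).comp (subsetInclusion hWO))
    rw [hFJd, Finset.sum_eq_single_of_mem J.succ hJ fun i hi hiJ => ?_] at hsum
    · rw [vrAJ, zsmul_zero, zero_add] at hsum
      exact eq_zero_of_zsmul_eq_zero_of_windH (m := -1) (by norm_num) (vrBJ J) hsum.symm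
    · revert hi hiJ
      refine Fin.cases (fun _ _ => ?_) (fun j _ hiJ => ?_) i
      · rw [vrA0, vrB0, zsmul_zero, zsmul_zero, add_zero]
      · have hjJ : j ≠ J := fun h => hiJ (by rw [h])
        rw [vrAother J j hjJ, vrBother J j hjJ, zsmul_zero, zsmul_zero, add_zero]
  -- conclusion
  refine ⟨if (0 : Fin (k + 1)) ∈ S then b 0 else 0, z₁, _, B₀.map ι₀.continuous, hz₁, hz₁co, hz₁lat, hz₁ann, hz₁pot,
    fun t => ⟨(hB₀ t).1, (hB₀ t).2⟩, ?_⟩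
  have hcB0 : cB 0 = loopClass ℤ ℤ (1 : ℤ) (B₀.map ι₀.continuous) := by simp only [hcB, Fin.cases_zero]
  rw [hd', ← hcB0]
  by_cases h0 : (0 : Fin (k + 1)) ∈ S
  · rw [if_pos h0, Finset.sum_eq_single_of_mem (0 : Fin (k + 1)) h0 fun i hi hi0 => ?_]
    · rw [ha0 h0, zero_zsmul, zero_add]
    · obtain ⟨j, rfl⟩ := Fin.exists_succ_eq.2 hi0
      rw [haJ j hi, hbJ j hi, zero_zsmul, zero_zsmul, add_zero]
  · rw [if_neg h0, zero_zsmul]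
    refine Finset.sum_eq_zero fun i hi => ?_
    have hi0 : i ≠ 0 := fun h => h0 (h ▸ hi)
    obtain ⟨j, rfl⟩ := Fin.exists_succ_eq.2 hi0
    rw [haJ j hi, hbJ j hi, zero_zsmul, zero_zsmul, add_zero]

end Summit.SmoothPoincare4.SmoothPoincare4.Theorems.DcrGap.MkFriends
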